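import Literature.NumberTheory.Automorphic.GL2CCuspFormOps
import Literature.NumberTheory.Automorphic.AutomorphicFormsEllipticAnnihilator
import Literature.NumberTheory.Automorphic.AutomorphicFormsSpan
import Literature.NumberTheory.Automorphic.AutomorphicRepsGLSatakeFlathProofs
import Literature.NumberTheory.Automorphic.ArchComplexPlaceCasimir
import HarnessLib

/-!
# `𝔨`-finiteness of the forms of a clean automorphic representation of `GL₂` over a totally
# complex field

The hypothesis `hfin` of the lowest-`K`-type theorem (`GL2CUnitaryKTypes.exists_isHW_two_mul`) for
the six operators `opsW` of `GL2CCuspFormOps` on the space `W` of forms of a clean `π`: every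
form lies in a finite-dimensional subspace of `W` stable under `E_k, F_k, H_k`.  Proof: the span of
the right `K_∞`-translates of an automorphic form is finite-dimensional (`K_∞`-finiteness,
Borel–Jacquet 1979, 4.2 (b)), lies in `W` (`W` is `K_∞`-stable) and is stable under the Lie
derivatives along `𝔨` (`lieDeriv_mem_kTranslateSpan_of_mem`, Borel 1997, 2.16), through which the
skew-Hermitian matrices at the complex place act (`GL2CArchOps.kFinite_of_skewHermitian_stable`).
[cite: BorelJacquetCorvallis1979, 4.2–4.3] [cite: Borel1997, 2.16]

Theorems only; no named fact.
-/

noncomputable section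

-- Mathlib idiom (Mathlib/Algebra/Lie/OfAssociative.lean), as in `GL2CCuspFormOps`.
attribute [local instance 100] LieRing.ofAssociativeRing

open scoped Matrix ComplexConjugate Classical
open Complex NumberField NumberField.mixedEmbedding NumberField.InfinitePlace

namespace Literature.NumberTheory.Automorphic

namespace GL2CCuspForm

open AutomorphicRepData GL2CKType GLnComplexCasimir ImaginaryQuadratic

variable {n : ℕ} {K : Type} [Field K] [NumberField K]

omit [NumberField K] in
/-- **The complex-place embedding commutes with the conjugate transpose**:
`(complexPlaceLie n w Y)ᴴ = complexPlaceLie n w Yᴴ`. [folklore] -/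
theorem star_complexPlaceLie (w : {w : InfinitePlace K // w.IsComplex}) (Y : Matrix (Fin n) (Fin n) ℂ) :
    star (complexPlaceLie n w Y) = complexPlaceLie n w (Yᴴ) := by
  rw [Matrix.star_eq_conjTranspose]
  ext i j : 1
  rw [Matrix.conjTranspose_apply, complexPlaceLie_apply, complexPlaceLie_apply, Matrix.conjTranspose_apply]
  refine Prod.ext (by simp) ?_
  change star (Pi.single (M := fun _ => ℂ) w (Y j i)) = Pi.single (M := fun _ => ℂ) w (star (Y j i))
  rw [Pi.single_star]

/-- **A skew-Hermitian matrix at a complex place exponentiates into `K_∞`**: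
`exp(t φ_w(Y)) ∈ K_∞` for `Yᴴ = -Y`. [cite: Knapp2002, §I.10 Prop. 1.87] -/
theorem expMem_smul_placeLie_mem_maximalCompact (w : {w : InfinitePlace K // w.IsComplex})
    {Y : Matrix (Fin n) (Fin n) ℂ} (hY : Yᴴ = -Y) (t : ℝ) :
    ((archGroupGL n K).expMem (t • ComplexPlace.placeLie n w Y) : GL (Fin n) (mixedSpace K)) ∈
      (archGroupGL n K).maximalCompact := by
  refine expMem_smul_mem_maximalCompact ?_ t
  rw [ComplexPlace.coe_placeLie, star_complexPlaceLie, hY, map_neg]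

variable [IsTotallyComplex K] {hcpt : isCompact_glFiniteIntegralLevel 2 K}
  (π : AutomorphicRepData (AutomorphyDatum.gl 2 K hcpt))

/-- **The `K_∞`-span of a form of `π` is a finite-dimensional subspace of `W` stable under the
skew-Hermitian matrices at the complex place.** [cite: Borel1997, 2.16] -/
theorem exists_skewHermitian_stable (h : π.W' = ⊥)
    {ρ𝔤 : (AutomorphyDatum.gl 2 K hcpt).arch.lie →ₗ⁅ℝ⁆ Module.End ℂ π.Quot} (hρ : π.HasLieAction ρ𝔤)
    (v : π.W) :
    ∃ S : Submodule ℂ π.W, v ∈ S ∧ FiniteDimensional ℂ S ∧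
      ∀ Y : Matrix (Fin 2) (Fin 2) ℂ, Yᴴ = -Y → ∀ x ∈ S,
        rhoAt (π.lieOnW h ρ𝔤) (complexPlace K) Y x ∈ S := by
  haveI : FiniteDimensional ℝ (mixedSpace K) := inferInstance
  have hvA : IsAutomorphicForm (AutomorphyDatum.gl 2 K hcpt) (v : _ → ℂ) :=
    isAutomorphicForm_of_mem_automorphicForms_gl (π.stable.le_automorphicForms v.2)
  haveI hFfin : FiniteDimensional ℂ (kTranslateSpan (AutomorphyDatum.gl 2 K hcpt).ofArch (v : _ → ℂ)) :=
    hvA.kFinite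
  -- the span lies in `W`
  have hFW : kTranslateSpan (AutomorphyDatum.gl 2 K hcpt).ofArch (v : _ → ℂ) ≤ π.W := by
    refine Submodule.span_le.2 ?_
    rintro _ ⟨k, rfl⟩
    exact π.stable.k_stable k v.2
  refine ⟨(kTranslateSpan (AutomorphyDatum.gl 2 K hcpt).ofArch (v : _ → ℂ)).comap π.W.subtype, ?_, ?_,
    fun Y hY x hx => ?_⟩
  · exact mem_kTranslateSpan_self (AutomorphyDatum.gl 2 K hcpt).ofArch (v : _ → ℂ)
  · exact LinearEquiv.finiteDimensional (Submodule.comapSubtypeEquivOfLe hFW).symm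
  · -- `Y x = X x` for the skew-Hermitian `X = complexPlaceLie Y ∈ 𝔨`
    rw [Submodule.mem_comap, Submodule.subtype_apply] at hx ⊢
    have e : ((rhoAt (π.lieOnW h ρ𝔤) (complexPlace K) Y x : π.W) : (AdelicGroupData.gl 2 K).Adelic → ℂ) =
        lieDeriv (AutomorphyDatum.gl 2 K hcpt).ofArch (ComplexPlace.placeLie 2 (complexPlace K) Y) x := by
      rw [rhoAt_apply, coe_lieOnW π h hρ]; rfl
    rw [e]
    exact lieDeriv_mem_kTranslateSpan_of_mem (AutomorphyDatum.gl 2 K hcpt).ofArch hvA.archSmooth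
      hvA.kFinite (fun t => expMem_smul_placeLie_mem_maximalCompact (complexPlace K) hY t) hx

/-- **`𝔨`-finiteness for the six operators on `W`**: every form of a clean `π` lies in a
finite-dimensional subspace of `W` stable under `E_k, F_k, H_k` (the hypothesis `hfin` of
`GL2CUnitaryKTypes.exists_isHW_two_mul`). [cite: BorelJacquetCorvallis1979, 4.2–4.3] [cite: Borel1997, 2.16] -/
theorem kFinite_opsW (h : π.W' = ⊥)
    {ρ𝔤 : (AutomorphyDatum.gl 2 K hcpt).arch.lie →ₗ⁅ℝ⁆ Module.End ℂ π.Quot} (hρ : π.HasLieAction ρ𝔤)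
    (v : π.W) :
    ∃ S : Submodule ℂ π.W, v ∈ S ∧ FiniteDimensional ℂ S ∧
      (∀ x ∈ S, (opsW π h ρ𝔤).Ek x ∈ S) ∧ (∀ x ∈ S, (opsW π h ρ𝔤).Fk x ∈ S) ∧
        (∀ x ∈ S, (opsW π h ρ𝔤).Hk x ∈ S) :=
  kFinite_of_skewHermitian_stable (rhoAt (π.lieOnW h ρ𝔤) (complexPlace K))
    (fun v => exists_skewHermitian_stable π h hρ v) v

end GL2CCuspForm

end Literature.NumberTheory.Automorphic

end
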